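import Mathlib

/-!
# Binomial coefficients mod 2 are `2^t`-periodic in the top argument below level `2^t`

`C(w + 2^t, k) ≡ C(w, k) (mod 2)` for `k < 2^t` (a corollary of Lucas' theorem): compare the
coefficients of `X^k` in `(1+X)^{w+2^t} = (1+X)^w (1 + X^{2^t}) = (1+X)^w + (1+X)^w X^{2^t}`
over `𝔽₂` (Frobenius `(1+X)^{2^t} = 1 + X^{2^t}`); the second summand has no monomial of degree
`< 2^t`. Helper for line Sketch of crux stmt-QuantumAdvantage-1392: a symmetric `𝔽₂`-phase of
degree `k < 2^t` of the binary digits is a function of the digit sum modulo `2^t`, hence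
2-automatic.
-/

set_option linter.dupNamespace false -- D-0017: single-problem summit ⇒ QuantumAdvantage.QuantumAdvantage by design

namespace Summit.QuantumAdvantage.QuantumAdvantage.Theorems.MobiusLadder

open Polynomial

/-- **Periodicity of Pascal's triangle mod 2.** For `k < 2^t` and every `w`,
`C(w + 2^t, k) ≡ C(w, k) (mod 2)`: the coefficient of `X^k` in
`(1+X)^{w+2^t} = (1+X)^w + (1+X)^w · X^{2^t}` over `ZMod 2` (Frobenius) only sees the first
summand. [folklore] -/
theorem choose_mod_two_periodic :
    ∀ t k w : ℕ, k < 2 ^ t → (((w + 2 ^ t).choose k : ℕ) : ZMod 2) = ((w.choose k : ℕ) : ZMod 2) := by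
  -- adapted from Literature.Combinatorics.Additive.natCast_choose_add_pow (p = 2)
  intro t k w hk
  have h1 : ((1 + X : (ZMod 2)[X]) ^ (w + 2 ^ t)).coeff k =
      ((1 + X : (ZMod 2)[X]) ^ w).coeff k := by
    rw [pow_add, add_pow_char_pow, one_pow, mul_add, mul_one, coeff_add, coeff_mul_X_pow',
      if_neg (not_le.2 hk), add_zero]
  rwa [coeff_one_add_X_pow, coeff_one_add_X_pow] at h1

end Summit.QuantumAdvantage.QuantumAdvantage.Theorems.MobiusLadder
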